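import Literature.NumberTheory.LFunctions.BurnolHardyRightTools
import Literature.NumberTheory.LFunctions.BurnolSonineFourier
import Literature.Analysis.DeBrangesSpaces.SonineMellinEntire
import Literature.Analysis.FunctionSpaces.PlancherelL1L2
import Mathlib.Analysis.SpecialFunctions.ImproperIntegrals
import Mathlib.Analysis.SpecialFunctions.Integrability.Basic
import Mathlib.Analysis.Complex.Convex
import HarnessLib

/-!
# Burnol 2004b, Prop. 4.1 (first clause) on the strip: the right Mellin transforms of `L_a` lie in
# `(s/(s−1)) A^s ℍ²`

LINE 1 — LABEL: RH-FREE (a Hardy-space membership statement about Mellin transforms of the extended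
Sonine space `L_a`; the Riemann zeta function does not occur). FRAMING (cell rh-crit, D-0074): corpus
theorem, RH-FREE literature. bears_on: B-C/B-P (LADDER-RH COLUMN 6, de Branges framework) as
infrastructure only. WHAT THIS IS NOT: not a route, not a criterion, no claim about the continuation
of `f̂` to `ℂ ∖ {1}` (Prop. 2.2); nothing here bears on the truth of RH.

Source: J.-F. Burnol, *Two complete and minimal systems associated with the zeros of the Riemann zeta
function*, J. Théor. Nombres Bordeaux 16 (2004) 65–94 = arXiv:math/0203120v7 (bib key `Burnol2004b`;
locators = arXiv v7 page + line of the TeX of record `dbl/src/Burnol2004JTNB_arXivmath0203120v7.tex`),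
§4, the paragraph before Prop. 4.1 and Prop. 4.1 itself (p. 7, TeX l.632–655): "the right Mellin
transform is an isometric identification of `L²(a,∞; dt)` with `A^s ℍ²`. Furthermore, the right Mellin
transform is an isometric identification of `ℂ·𝟙_{0<t<a} + L²(a,∞; dt)` with `(s/(s−1)) A^s ℍ²`.
This leads to the following characterization of `L̂_a`: The subspace `L̂_a` … consists of the
measurable functions `F(s)` on the critical line which belong to `(s/(s−1)) A^s ℍ²` and are such that
`χ(s)F(1−s)` also belongs to `(s/(s−1)) A^s ℍ²` …" (`A = 1/a`).

## What is proved (all theorems; no definition, no named fact)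

The typed fact `Burnol2004b_prop4_1` (`BurnolZetaSystemsHardy.lean`) words clause (i) as
`IsHardyRight (fun s ↦ (a:ℂ)^s * ((s−1)/s) * rightMellinExt f s)`; that LITERAL function takes the
value `0` at `s = 1` while its limit there is `−a·c` (`c` = the constant value of `f` on `(0,a)`), so
the literal wording is unsatisfiable whenever `c ≠ 0` (cell record dbl/STATUS 2026-08-26 11:06Z /
11:10Z, "misstated-as-typed: junk value at the removable singularity"). The printed meaning — "`f̂`
belongs to `(s/(s−1))A^sℍ²`", i.e. `a^s·((s−1)/s)·f̂(s)`, continued across `s = 1`, is an element of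
`ℍ²` — is proved here in the junk-free form ON THE STRIP `1/2 < Re s < 1`, where Burnol's `f̂(s)` is the
absolutely convergent integral `rightMellin f s` (docstring of `rightMellin`):

* `isHardyRight_inv` — `1/s ∈ ℍ²(Re s > 1/2)` (the Mellin transform of `𝟙_{0<t<1}` up to the factor
  `s/(s−1)`; TeX l.638–641).
* `isHardyRight_cpow_mul_mellin` — for `g ∈ L²(ℝ)` vanishing on `(−∞, a]`, `a > 0`:
  `s ↦ a^s ∫_a^∞ g(t)t^{−s}dt ∈ ℍ²` ("the right Mellin transform is an isometric identification of
  `L²(a,∞;dt)` with `A^sℍ²`", TeX l.632–638; only the membership direction, by Mellin–Plancherel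
  `Literature.Analysis.FunctionSpaces.integral_norm_sq_mellin_eq` on each line `Re s = σ > 1/2`:
  `∫|ĝ(σ+iτ)|²dτ = 2π∫_a^∞|g|²t^{1−2σ}dt ≤ 2π a^{1−2σ}‖g‖²`, and holomorphy by
  `Literature.Analysis.DeBrangesSpaces.SonineMellin.differentiableOn_mellin`).
* `rightMellin_eq_of_ae_eq_const` — for `f ∈ L²(ℝ)` with `f = c` a.e. on `(0,a)` and
  `1/2 < Re s < 1`: `f̂(s) = c·a^{1−s}/(1−s) + ∫_a^∞ f(t)t^{−s}dt` (TeX l.638–643, the decomposition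
  `ℂ·𝟙_{0<t<a} + L²(a,∞)`).
* `exists_isHardyRight_eq_rightMellin` — hence `∃ F ∈ ℍ²` with
  `F(s) = a^s·((s−1)/s)·f̂(s)` on the strip, namely `F(s) = −c·a/s + ((s−1)/s)·a^s∫_a^∞ f t^{−s}`.
* `Burnol2004b_prop4_1_i_strip` — **Prop. 4.1, first clause, for `f ∈ L_a`: both `f̂` and `(𝓕f)^`
  belong to `(s/(s−1))A^sℍ²`** in the above sense (`𝓕 f ∈ L_a` by `fourier_mem_sonineL`).
* `Burnol2004b_prop4_1_i_of_continuation` — the bridge to the continued transform: if `G` is ANY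
  holomorphic continuation of `f̂` to `ℂ ∖ {1}` (`HasRightMellinContinuation f G`, as asserted by
  Prop. 2.2), the `ℍ²` function `F` agrees with `a^s·((s−1)/s)·G(s)` on the punctured half-plane
  `{Re s > 1/2} ∖ {1}` (identity theorem on that connected open set).

## References

* J.-F. Burnol, op. cit., §4 (arXiv:math/0203120v7 p. 7, TeX l.626–669). [key `Burnol2004b`]
* E. C. Titchmarsh, *Introduction to the theory of Fourier integrals*, Thm. 71 (Mellin–Parseval),
  as vendored in `Literature/Analysis/FunctionSpaces/PlancherelL1L2.lean`. [folklore]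
-/

noncomputable section

open MeasureTheory Complex Filter Set Real
open scoped Topology FourierTransform

namespace Literature.NumberTheory.LFunctions

namespace Burnol2004bHardyStrip

/-! ### `1/s ∈ ℍ²` -/

/-- On the line `Re s = σ > 1/2`: `‖1/(σ+iτ)‖² ≤ 4/(1+τ²)`. [folklore] -/
private theorem norm_inv_line_sq_le {σ : ℝ} (hσ : 1 / 2 < σ) (τ : ℝ) :
    ‖((σ : ℂ) + τ * I)⁻¹‖ ^ 2 ≤ 4 * (1 + τ ^ 2)⁻¹ := by
  rw [norm_inv, inv_pow, Complex.sq_norm, Complex.normSq_add_mul_I]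
  have h1 : (1 + τ ^ 2) / 4 ≤ σ ^ 2 + τ ^ 2 := by nlinarith [sq_nonneg τ]
  have h2 : (0 : ℝ) < (1 + τ ^ 2) / 4 := by positivity
  calc (σ ^ 2 + τ ^ 2)⁻¹ ≤ ((1 + τ ^ 2) / 4)⁻¹ := inv_anti₀ h2 h1
    _ = 4 * (1 + τ ^ 2)⁻¹ := by rw [inv_div, div_eq_mul_inv]

/-- `s ↦ 1/s` belongs to `ℍ²(Re s > 1/2)`: holomorphic there and `∫ dτ/|σ+iτ|² = π/σ ≤ 4π`
(the factor `1/s` of `𝟙̂_{0<t<a}(s) = a^{1−s}/(1−s) = −(s/(s−1))·a^{1−s}/s`, TeX l.638–641).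
[cite: Burnol2004b, §4 before Prop. 4.1 (arXiv:math/0203120v7 p. 7, TeX l.632–643)] -/
theorem isHardyRight_inv : IsHardyRight (fun s : ℂ ↦ s⁻¹) := by
  have hne : ∀ s ∈ {s : ℂ | 1 / 2 < s.re}, s ≠ 0 := by
    intro s hs h0
    simp only [mem_setOf_eq, h0, Complex.zero_re] at hs
    linarith
  have hdiff : DifferentiableOn ℂ (fun s : ℂ ↦ s⁻¹) {s | 1 / 2 < s.re} :=
    differentiableOn_id.inv hne
  refine ⟨hdiff, 4 * Real.pi, fun σ hσ ↦ ?_⟩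
  have hmeas : AEStronglyMeasurable (fun τ : ℝ ↦ ((σ : ℂ) + τ * I)⁻¹) volume :=
    (IsHardyRight.continuous_line hdiff hσ).aestronglyMeasurable
  have hdom : Integrable (fun τ : ℝ ↦ 4 * (1 + τ ^ 2)⁻¹) := integrable_inv_one_add_sq.const_mul 4
  have hint : Integrable (fun τ : ℝ ↦ ‖((σ : ℂ) + τ * I)⁻¹‖ ^ 2) := by
    refine hdom.mono' (hmeas.norm.pow 2) (Eventually.of_forall fun τ ↦ ?_)
    rw [Real.norm_eq_abs, abs_of_nonneg (by positivity)]
    exact norm_inv_line_sq_le hσ τ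
  refine ⟨(memLp_two_iff_integrable_sq_norm hmeas).2 hint, ?_⟩
  calc ∫ τ : ℝ, ‖((σ : ℂ) + τ * I)⁻¹‖ ^ 2 ≤ ∫ τ : ℝ, 4 * (1 + τ ^ 2)⁻¹ :=
        integral_mono hint hdom (fun τ ↦ norm_inv_line_sq_le hσ τ)
    _ = 4 * Real.pi := by rw [integral_const_mul, integral_univ_inv_one_add_sq]

/-! ### The tail transform `s ↦ a^s ∫_a^∞ g(t) t^{-s} dt` for `g ∈ L²` vanishing on `(-∞, a]` -/

section Tail

variable {a : ℝ} (ha : 0 < a) {g : ℝ → ℂ} (hg : MemLp g 2 (volume : Measure ℝ))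
  (h0 : ∀ x : ℝ, x ≤ a → g x = 0)

include ha hg h0 in
/-- Holomorphy of `w ↦ ∫_0^∞ g(t)t^{w−1}dt` on `Re w < 1/2` for `g ∈ L²` vanishing on `(−∞,a]`
(Burnol 2001 CRAS §1, vendored as `SonineMellin.differentiableOn_mellin` for `L²` classes).
[cite: Burnol2004b, §4 before Prop. 4.1 (arXiv:math/0203120v7 p. 7, TeX l.632–638)] -/
private theorem differentiableOn_mellin_tail :
    DifferentiableOn ℂ (mellin g) {w | w.re < 1 / 2} := by
  set gL : Lp ℂ 2 (volume : Measure ℝ) := hg.toLp g with hgL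
  have hcoe : (gL : ℝ → ℂ) =ᵐ[volume] g := hg.coeFn_toLp
  have hga : ∀ᵐ x : ℝ, x ∈ Icc (-a) a → (gL : ℝ → ℂ) x = 0 := by
    filter_upwards [hcoe] with x hx hxI
    rw [hx, h0 x hxI.2]
  have hD := Literature.Analysis.DeBrangesSpaces.SonineMellin.differentiableOn_mellin ha gL hga
  have heq : mellin (gL : ℝ → ℂ) = mellin g := by
    funext w
    simp only [mellin]
    refine integral_congr_ae ?_
    filter_upwards [ae_restrict_of_ae (s := Ioi (0 : ℝ)) hcoe] with t ht
    rw [ht]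
  rwa [heq] at hD

include h0 in
/-- The integrands of the tail transform vanish on `(−∞, a]`, so they are indicators of `(a, ∞)`.
[folklore] -/
private theorem indicator_eq {φ : ℝ → ℂ} : (Ioi a).indicator (fun t ↦ φ t * g t) = fun t ↦ φ t * g t := by
  funext t
  by_cases ht : t ∈ Ioi a
  · rw [indicator_of_mem ht]
  · rw [indicator_of_notMem ht, h0 t (not_lt.1 ht), mul_zero]

include ha in
/-- `t ↦ t^z ∈ L²(a,∞)` for `Re z < −1/2` (`a > 0`). [folklore] -/
private theorem memLp_cpow_Ioi {z : ℂ} (hz : z.re < -1 / 2) :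
    MemLp (fun t : ℝ ↦ (t : ℂ) ^ z) 2 (volume.restrict (Ioi a)) := by
  have hc : ContinuousOn (fun t : ℝ ↦ (t : ℂ) ^ z) (Ioi a) := fun t ht ↦
    (continuousAt_ofReal_cpow_const _ _ (Or.inr (ha.trans ht).ne')).continuousWithinAt
  rw [memLp_two_iff_integrable_sq_norm (hc.aestronglyMeasurable measurableSet_Ioi)]
  have h2 : IntegrableOn (fun t : ℝ ↦ t ^ (2 * z.re)) (Ioi a) :=
    integrableOn_Ioi_rpow_of_lt (by linarith) ha
  refine h2.congr_fun (fun t ht ↦ ?_) measurableSet_Ioi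
  have ht0 : 0 < t := ha.trans ht
  rw [norm_cpow_eq_rpow_re_of_pos ht0, ← Real.rpow_natCast, ← Real.rpow_mul ht0.le]
  push_cast; ring_nf

include ha hg h0 in
/-- Absolute convergence of `∫_0^∞ g(t)t^{σ'−1}dt` for `σ' < 1/2` (Cauchy–Schwarz on `(a,∞)`:
`t^{σ'−1} ∈ L²(a,∞)`). [cite: Burnol2004b, §1 (arXiv:math/0203120v7 p. 4, TeX l.350–355)] -/
private theorem mellinConvergent_tail {σ' : ℝ} (hσ' : σ' < 1 / 2) : MellinConvergent g (σ' : ℂ) := by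
  have hpow : MemLp (fun t : ℝ ↦ (t : ℂ) ^ ((σ' : ℂ) - 1)) 2 (volume.restrict (Ioi a)) :=
    memLp_cpow_Ioi ha (by simp only [sub_re, ofReal_re, one_re]; linarith)
  have hprod : Integrable (fun t : ℝ ↦ (t : ℂ) ^ ((σ' : ℂ) - 1) * g t) (volume.restrict (Ioi a)) :=
    hpow.integrable_mul (hg.restrict _)
  have hI : IntegrableOn (fun t : ℝ ↦ (t : ℂ) ^ ((σ' : ℂ) - 1) * g t) (Ioi a) := hprod
  have hall : Integrable (fun t : ℝ ↦ (t : ℂ) ^ ((σ' : ℂ) - 1) * g t) := by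
    rw [← indicator_eq h0, integrable_indicator_iff measurableSet_Ioi]
    exact hI
  simpa [MellinConvergent, smul_eq_mul] using hall.integrableOn

include hg h0 in
/-- The weight bound on `(a,∞)`: `∫_0^∞ |g|² x^{2σ'−1} ≤ a^{2σ'−1} ‖g‖²` for `σ' < 1/2`, with
integrability. [cite: Burnol2004b, §4 before Prop. 4.1 (arXiv:math/0203120v7 p. 7, TeX l.632–638)] -/
private theorem weight_tail (ha : 0 < a) {σ' : ℝ} (hσ' : σ' < 1 / 2) :
    IntegrableOn (fun x : ℝ ↦ ‖g x‖ ^ 2 * x ^ (2 * σ' - 1)) (Ioi 0) ∧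
      ∫ x in Ioi 0, ‖g x‖ ^ 2 * x ^ (2 * σ' - 1) ≤ a ^ (2 * σ' - 1) * ∫ x, ‖g x‖ ^ 2 := by
  have hsq : Integrable (fun x : ℝ ↦ ‖g x‖ ^ 2) := (memLp_two_iff_integrable_sq_norm hg.1).1 hg
  -- the integrand vanishes off `(a, ∞)`
  have hind : (Ioi a).indicator (fun x : ℝ ↦ ‖g x‖ ^ 2 * x ^ (2 * σ' - 1)) =
      fun x ↦ ‖g x‖ ^ 2 * x ^ (2 * σ' - 1) := by
    funext x
    by_cases hx : x ∈ Ioi a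
    · rw [indicator_of_mem hx]
    · rw [indicator_of_notMem hx, h0 x (not_lt.1 hx), norm_zero]; ring
  have hbd : ∀ᵐ x ∂(volume.restrict (Ioi a)), ‖(x : ℝ) ^ (2 * σ' - 1)‖ ≤ a ^ (2 * σ' - 1) := by
    filter_upwards [ae_restrict_mem measurableSet_Ioi] with x hx
    have hx0 : 0 < x := ha.trans hx
    rw [Real.norm_eq_abs, abs_of_nonneg (Real.rpow_nonneg hx0.le _)]
    exact Real.rpow_le_rpow_of_nonpos ha hx.le (by linarith)
  have hmeas : AEStronglyMeasurable (fun x : ℝ ↦ x ^ (2 * σ' - 1)) (volume.restrict (Ioi a)) :=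
    (ContinuousOn.aestronglyMeasurable (fun x hx ↦
      (Real.continuousAt_rpow_const _ _ (Or.inl (ha.trans hx).ne')).continuousWithinAt)
      measurableSet_Ioi)
  have hIa : IntegrableOn (fun x : ℝ ↦ ‖g x‖ ^ 2 * x ^ (2 * σ' - 1)) (Ioi a) :=
    Integrable.mul_bdd hsq.integrableOn hmeas hbd
  have hall : Integrable (fun x : ℝ ↦ ‖g x‖ ^ 2 * x ^ (2 * σ' - 1)) := by
    rw [← hind, integrable_indicator_iff measurableSet_Ioi]
    exact hIa
  refine ⟨hall.integrableOn, ?_⟩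
  have e1 : ∫ x in Ioi 0, ‖g x‖ ^ 2 * x ^ (2 * σ' - 1) = ∫ x in Ioi a, ‖g x‖ ^ 2 * x ^ (2 * σ' - 1) := by
    rw [← hind, setIntegral_indicator measurableSet_Ioi, hind,
      show Ioi (0 : ℝ) ∩ Ioi a = Ioi a from by rw [inter_eq_right]; exact Ioi_subset_Ioi ha.le]
  rw [e1]
  calc ∫ x in Ioi a, ‖g x‖ ^ 2 * x ^ (2 * σ' - 1)
      ≤ ∫ x in Ioi a, a ^ (2 * σ' - 1) * ‖g x‖ ^ 2 := by
        refine integral_mono_ae hIa (hsq.integrableOn.const_mul _) ?_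
        filter_upwards [ae_restrict_mem measurableSet_Ioi] with x hx
        have hx0 : 0 < x := ha.trans hx
        have hle : x ^ (2 * σ' - 1) ≤ a ^ (2 * σ' - 1) :=
          Real.rpow_le_rpow_of_nonpos ha hx.le (by linarith)
        have h0' : 0 ≤ ‖g x‖ ^ 2 := by positivity
        nlinarith
    _ = a ^ (2 * σ' - 1) * ∫ x in Ioi a, ‖g x‖ ^ 2 := integral_const_mul _ _
    _ ≤ a ^ (2 * σ' - 1) * ∫ x, ‖g x‖ ^ 2 :=
        mul_le_mul_of_nonneg_left
          (setIntegral_le_integral hsq (Eventually.of_forall fun x ↦ by positivity))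
          (Real.rpow_nonneg ha.le _)

include ha hg h0 in
/-- **Mellin–Plancherel on the line `Re s = σ > 1/2`** for the tail transform:
`τ ↦ |∫_a^∞ g(t)t^{−(σ+iτ)}dt|²` is integrable and `∫ |ĝ(σ+iτ)|² dτ ≤ 2π a^{1−2σ} ‖g‖²`.
[cite: Burnol2004b, §4 before Prop. 4.1 (arXiv:math/0203120v7 p. 7, TeX l.632–638)] -/
private theorem line_tail {σ : ℝ} (hσ : 1 / 2 < σ) :
    Integrable (fun τ : ℝ ↦ ‖mellin g (1 - ((σ : ℂ) + τ * I))‖ ^ 2) ∧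
      ∫ τ : ℝ, ‖mellin g (1 - ((σ : ℂ) + τ * I))‖ ^ 2 ≤
        2 * Real.pi * a ^ (1 - 2 * σ) * ∫ x, ‖g x‖ ^ 2 := by
  have hσ' : 1 - σ < 1 / 2 := by linarith
  obtain ⟨hP1, hP2⟩ := Literature.Analysis.FunctionSpaces.integral_norm_sq_mellin_eq
    (mellinConvergent_tail ha hg h0 hσ') (weight_tail hg h0 ha hσ').1
  have hW := (weight_tail hg h0 ha hσ').2
  -- `1 - (σ + iτ) = (1 - σ) + i(-τ)`
  have e : ∀ τ : ℝ, (1 : ℂ) - ((σ : ℂ) + τ * I) = ((1 - σ : ℝ) : ℂ) + ((-1 * τ : ℝ) : ℂ) * I := by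
    intro τ; push_cast; ring
  have hfun : (fun τ : ℝ ↦ ‖mellin g (1 - ((σ : ℂ) + τ * I))‖ ^ 2) =
      fun τ : ℝ ↦ (fun u : ℝ ↦ ‖mellin g (((1 - σ : ℝ) : ℂ) + u * I)‖ ^ 2) (-1 * τ) := by
    funext τ; simp only [e]
  rw [hfun]
  refine ⟨hP1.comp_mul_left' (by norm_num), ?_⟩
  rw [Measure.integral_comp_mul_left (fun u : ℝ ↦ ‖mellin g (((1 - σ : ℝ) : ℂ) + u * I)‖ ^ 2) (-1 : ℝ)]
  simp only [inv_neg, inv_one, abs_neg, abs_one, one_smul]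
  rw [hP2, show 2 * (1 - σ) - 1 = 1 - 2 * σ by ring]
  have h2π : (0 : ℝ) ≤ 2 * Real.pi := by positivity
  calc 2 * Real.pi * ∫ x in Ioi 0, ‖g x‖ ^ 2 * x ^ (1 - 2 * σ)
      ≤ 2 * Real.pi * (a ^ (1 - 2 * σ) * ∫ x, ‖g x‖ ^ 2) := by
        apply mul_le_mul_of_nonneg_left _ h2π
        have := hW
        rwa [show 2 * (1 - σ) - 1 = 1 - 2 * σ by ring] at this
    _ = 2 * Real.pi * a ^ (1 - 2 * σ) * ∫ x, ‖g x‖ ^ 2 := by ring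

include ha hg h0 in
/-- **`s ↦ a^s ∫_a^∞ g(t)t^{−s}dt ∈ ℍ²(Re s > 1/2)`** for `g ∈ L²(ℝ)` vanishing on `(−∞,a]` — the
membership half of "the right Mellin transform is an isometric identification of `L²(a,∞;dt)` with
`A^sℍ²`" (`A = 1/a`): holomorphic on `Re s > 1/2`, and on `Re s = σ`,
`∫|a^s ĝ(s)|²dτ = a^{2σ}·2π∫_a^∞|g|²t^{1−2σ} ≤ 2πa‖g‖²`, uniformly in `σ`.
[cite: Burnol2004b, §4 before Prop. 4.1 (arXiv:math/0203120v7 p. 7, TeX l.632–638)] -/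
theorem isHardyRight_cpow_mul_mellin :
    IsHardyRight (fun s : ℂ ↦ (a : ℂ) ^ s * mellin g (1 - s)) := by
  have ha0 : (a : ℂ) ≠ 0 := ofReal_ne_zero.2 ha.ne'
  -- holomorphy
  have hmel : DifferentiableOn ℂ (fun s : ℂ ↦ mellin g (1 - s)) {s | 1 / 2 < s.re} := by
    refine (differentiableOn_mellin_tail ha hg h0).comp
      ((differentiableOn_const (1 : ℂ)).sub differentiableOn_id) (fun s hs ↦ ?_)
    simp only [mem_setOf_eq, sub_re, one_re] at hs ⊢
    linarith
  have hdiff : DifferentiableOn ℂ (fun s : ℂ ↦ (a : ℂ) ^ s * mellin g (1 - s)) {s | 1 / 2 < s.re} := by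
    refine DifferentiableOn.mul (fun s _ ↦ ?_) hmel
    exact (differentiableAt_id.const_cpow (Or.inl ha0)).differentiableWithinAt
  refine ⟨hdiff, 2 * Real.pi * a * ∫ x, ‖g x‖ ^ 2, fun σ hσ ↦ ?_⟩
  obtain ⟨hL1, hL2⟩ := line_tail ha hg h0 hσ
  have hmeas : AEStronglyMeasurable
      (fun τ : ℝ ↦ (a : ℂ) ^ ((σ : ℂ) + τ * I) * mellin g (1 - ((σ : ℂ) + τ * I))) volume :=
    (IsHardyRight.continuous_line hdiff hσ).aestronglyMeasurable
  -- `|a^{σ+iτ}|² = a^{2σ}`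
  have hnorm : ∀ τ : ℝ, ‖(a : ℂ) ^ ((σ : ℂ) + τ * I) * mellin g (1 - ((σ : ℂ) + τ * I))‖ ^ 2 =
      a ^ (2 * σ) * ‖mellin g (1 - ((σ : ℂ) + τ * I))‖ ^ 2 := by
    intro τ
    rw [norm_mul, mul_pow, norm_cpow_eq_rpow_re_of_pos ha]
    simp only [add_re, ofReal_re, mul_re, I_re, mul_zero, ofReal_im, I_im, mul_one, sub_self,
      add_zero]
    rw [← Real.rpow_natCast, ← Real.rpow_mul ha.le]
    congr 2; push_cast; ring
  have hint : Integrable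
      (fun τ : ℝ ↦ ‖(a : ℂ) ^ ((σ : ℂ) + τ * I) * mellin g (1 - ((σ : ℂ) + τ * I))‖ ^ 2) := by
    simp_rw [hnorm]
    exact hL1.const_mul _
  refine ⟨(memLp_two_iff_integrable_sq_norm hmeas).2 hint, ?_⟩
  simp_rw [hnorm]
  rw [integral_const_mul]
  have hN : 0 ≤ ∫ x, ‖g x‖ ^ 2 := integral_nonneg fun x ↦ by positivity
  calc a ^ (2 * σ) * ∫ τ : ℝ, ‖mellin g (1 - ((σ : ℂ) + τ * I))‖ ^ 2
      ≤ a ^ (2 * σ) * (2 * Real.pi * a ^ (1 - 2 * σ) * ∫ x, ‖g x‖ ^ 2) :=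
        mul_le_mul_of_nonneg_left hL2 (Real.rpow_nonneg ha.le _)
    _ = 2 * Real.pi * (a ^ (2 * σ) * a ^ (1 - 2 * σ)) * ∫ x, ‖g x‖ ^ 2 := by ring
    _ = 2 * Real.pi * a * ∫ x, ‖g x‖ ^ 2 := by
        rw [← Real.rpow_add ha, show 2 * σ + (1 - 2 * σ) = 1 by ring, Real.rpow_one]

end Tail

/-! ### The decomposition `f̂(s) = c·a^{1−s}/(1−s) + ∫_a^∞ f(t)t^{−s}dt` on the strip -/

/-- Almost every point of `(0, a]` lies in `(0, a)` (Lebesgue). [folklore] -/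
private theorem ae_restrict_Ioc_mem_Ioo (a : ℝ) :
    ∀ᵐ x ∂(volume.restrict (Ioc (0 : ℝ) a)), x ∈ Ioo 0 a := by
  have hne : {a}ᶜ ∈ ae (volume : Measure ℝ) := compl_mem_ae_iff.2 (measure_singleton a)
  filter_upwards [ae_restrict_mem measurableSet_Ioc, ae_restrict_of_ae hne] with x hx hxa
  exact ⟨hx.1, lt_of_le_of_ne hx.2 hxa⟩

end Burnol2004bHardyStrip

open Burnol2004bHardyStrip in
/-- **The decomposition behind Prop. 4.1** ("the right Mellin transform is an isometric identification
of `ℂ·𝟙_{0<t<a} + L²(a,∞;dt)` with `(s/(s−1))A^sℍ²`", TeX l.638–643): for `f ∈ L²(ℝ)` with `f = c`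
a.e. on `(0,a)` (`a > 0`) and `1/2 < Re s < 1`, the absolutely convergent right Mellin transform splits
as `f̂(s) = c·a^{1−s}/(1−s) + ∫_a^∞ f(t)t^{−s}dt`.
[cite: Burnol2004b, §4 before Prop. 4.1 (arXiv:math/0203120v7 p. 7, TeX l.632–643)] -/
theorem rightMellin_eq_of_ae_eq_const {a : ℝ} (ha : 0 < a) (f : ℝ → ℂ)
    (hf : MemLp f 2 (volume : Measure ℝ)) {c : ℂ} (hfc : ∀ᵐ x : ℝ, x ∈ Ioo 0 a → f x = c) {s : ℂ}
    (hs1 : 1 / 2 < s.re) (hs2 : s.re < 1) :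
    rightMellin f s = c * (a : ℂ) ^ (1 - s) / (1 - s) + mellin ((Ioi a).indicator f) (1 - s) := by
  have hs0 : -1 < (-s).re := by simp only [neg_re]; linarith
  have h1s : (-s : ℂ) + 1 ≠ 0 := by
    intro h
    have := congrArg Complex.re h
    simp only [add_re, neg_re, one_re, zero_re] at this
    linarith
  have e : (1 : ℂ) - s - 1 = -s := by ring
  simp only [rightMellin, mellin, e, smul_eq_mul]
  -- integrability on the two pieces
  have hae : ∀ᵐ t : ℝ ∂(volume.restrict (Ioc (0 : ℝ) a)),
      c * (t : ℂ) ^ (-s) = (t : ℂ) ^ (-s) * f t := by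
    filter_upwards [ae_restrict_Ioc_mem_Ioo a, ae_restrict_of_ae (s := Ioc (0 : ℝ) a) hfc]
      with t ht htc
    rw [htc ht, mul_comm]
  have hI1 : IntegrableOn (fun t : ℝ ↦ (t : ℂ) ^ (-s) * f t) (Ioc 0 a) := by
    have h : IntegrableOn (fun t : ℝ ↦ c * (t : ℂ) ^ (-s)) (Ioc 0 a) :=
      ((intervalIntegral.intervalIntegrable_cpow' hs0 (a := 0) (b := a)).1).const_mul c
    exact h.congr_fun_ae hae
  have hI2 : IntegrableOn (fun t : ℝ ↦ (t : ℂ) ^ (-s) * f t) (Ioi a) :=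
    (memLp_cpow_Ioi ha (by simp only [neg_re]; linarith)).integrable_mul (hf.restrict _)
  have hsplit : ∫ t in Ioi (0 : ℝ), (t : ℂ) ^ (-s) * f t =
      (∫ t in Ioc (0 : ℝ) a, (t : ℂ) ^ (-s) * f t) + ∫ t in Ioi a, (t : ℂ) ^ (-s) * f t := by
    rw [← setIntegral_union Ioc_disjoint_Ioi_same measurableSet_Ioi hI1 hI2,
      Ioc_union_Ioi_eq_Ioi ha.le]
  rw [hsplit]
  congr 1
  · -- the constant piece: `∫_0^a c t^{-s} dt = c a^{1-s}/(1-s)`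
    rw [← integral_congr_ae hae, integral_const_mul, ← intervalIntegral.integral_of_le ha.le,
      integral_cpow (Or.inl hs0), ofReal_zero, zero_cpow h1s, sub_zero, neg_add_eq_sub]
    ring
  · -- the tail piece
    have hind : (fun t : ℝ ↦ (t : ℂ) ^ (-s) * (Ioi a).indicator f t) =
        (Ioi a).indicator (fun t : ℝ ↦ (t : ℂ) ^ (-s) * f t) := by
      funext t
      by_cases ht : t ∈ Ioi a
      · rw [indicator_of_mem ht, indicator_of_mem ht]
      · rw [indicator_of_notMem ht, indicator_of_notMem ht, mul_zero]
    rw [hind, setIntegral_indicator measurableSet_Ioi,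
      show Ioi (0 : ℝ) ∩ Ioi a = Ioi a from by rw [inter_eq_right]; exact Ioi_subset_Ioi ha.le]

open Burnol2004bHardyStrip in
/-- **`ℂ·𝟙_{0<t<a} + L²(a,∞;dt)` is carried into `(s/(s−1))A^sℍ²`** (membership direction of the
isometric identification, TeX l.638–643): for `f ∈ L²(ℝ)` with `f = c` a.e. on `(0,a)`, the function
`F(s) = −c·a/s + ((s−1)/s)·a^s∫_a^∞ f(t)t^{−s}dt` belongs to `ℍ²(Re s > 1/2)` and equals
`a^s·((s−1)/s)·f̂(s)` on the strip `1/2 < Re s < 1`.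
[cite: Burnol2004b, §4 before Prop. 4.1 (arXiv:math/0203120v7 p. 7, TeX l.632–643)] -/
theorem exists_isHardyRight_eq_rightMellin {a : ℝ} (ha : 0 < a) (f : ℝ → ℂ)
    (hf : MemLp f 2 (volume : Measure ℝ)) {c : ℂ} (hfc : ∀ᵐ x : ℝ, x ∈ Ioo 0 a → f x = c) :
    ∃ F : ℂ → ℂ, IsHardyRight F ∧
      ∀ s : ℂ, 1 / 2 < s.re → s.re < 1 → F s = (a : ℂ) ^ s * ((s - 1) / s) * rightMellin f s := by
  have ha0 : (a : ℂ) ≠ 0 := ofReal_ne_zero.2 ha.ne'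
  have hg : MemLp ((Ioi a).indicator f) 2 (volume : Measure ℝ) := hf.indicator measurableSet_Ioi
  have h0 : ∀ x : ℝ, x ≤ a → (Ioi a).indicator f x = 0 :=
    fun x hx ↦ indicator_of_notMem (show x ∉ Ioi a from not_lt.2 hx) f
  have hT := isHardyRight_cpow_mul_mellin ha hg h0
  have hne : ∀ s ∈ {s : ℂ | 1 / 2 < s.re}, s ≠ 0 := by
    intro s hs h
    simp only [mem_setOf_eq, h, Complex.zero_re] at hs
    linarith
  have hφd : DifferentiableOn ℂ (fun s : ℂ ↦ (s - 1) / s) {s | 1 / 2 < s.re} :=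
    (differentiableOn_id.sub (differentiableOn_const (1 : ℂ))).div differentiableOn_id hne
  have hφb : ∀ s : ℂ, 1 / 2 < s.re → ‖(s - 1) / s‖ ≤ 3 := by
    intro s hs
    have hs0 : s ≠ 0 := hne s hs
    have h1 : 1 / 2 < ‖s‖ := lt_of_lt_of_le hs (le_trans (le_abs_self _) (Complex.abs_re_le_norm s))
    have hinv : ‖s⁻¹‖ ≤ 2 := by
      rw [norm_inv]
      calc ‖s‖⁻¹ ≤ (1 / 2)⁻¹ := inv_anti₀ (by norm_num) h1.le
        _ = 2 := by norm_num
    rw [sub_div, div_self hs0, div_eq_mul_inv, one_mul]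
    calc ‖1 - s⁻¹‖ ≤ ‖(1 : ℂ)‖ + ‖s⁻¹‖ := norm_sub_le _ _
      _ ≤ 1 + 2 := by rw [norm_one]; linarith
      _ = 3 := by norm_num
  have hQ := hT.mul_of_bounded hφd hφb
  have hP := isHardyRight_inv.const_mul (-(c * a))
  refine ⟨fun s ↦ -(c * a) * s⁻¹ +
      (s - 1) / s * ((a : ℂ) ^ s * mellin ((Ioi a).indicator f) (1 - s)), hP.add hQ,
    fun s hs1 hs2 ↦ ?_⟩
  dsimp only
  have hs0 : s ≠ 0 := hne s hs1
  have h1s : (1 : ℂ) - s ≠ 0 := by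
    intro h
    have := congrArg Complex.re h
    simp only [sub_re, one_re, zero_re] at this
    linarith
  rw [rightMellin_eq_of_ae_eq_const ha f hf hfc hs1 hs2]
  have hAB : (a : ℂ) ^ s * (a : ℂ) ^ (1 - s) = a := by
    rw [← cpow_add _ _ ha0, add_sub_cancel, cpow_one]
  set A : ℂ := (a : ℂ) ^ s
  set B : ℂ := (a : ℂ) ^ (1 - s)
  set M : ℂ := mellin ((Ioi a).indicator f) (1 - s)
  rw [← hAB]
  field_simp
  ring

/-- **Prop. 4.1, first clause, for `f ∈ L_a` (junk-free strip form).** For `a > 0` and `f ∈ L_a`: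
(1) there is `F ∈ ℍ²(Re s > 1/2)` with `F(s) = a^s·((s−1)/s)·f̂(s)` for `1/2 < Re s < 1` — i.e. `f̂`
belongs to `(s/(s−1))A^sℍ²`, `A = 1/a`; (2) the same for the cosine transform `𝓕f` (which lies in
`L_a` again, `fourier_mem_sonineL`) — i.e. `χ(s)f̂(1−s) = (𝓕f)^(s)` belongs to `(s/(s−1))A^sℍ²`.
Here `f̂ = rightMellin f` is the absolutely convergent integral on the strip; for the continued
transform see `Burnol2004b_prop4_1_i_of_continuation`. The literal wording of clause (i) in the
typed fact `Burnol2004b_prop4_1` (value `0` forced at `s = 1`) is not asserted.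
[cite: Burnol2004b, Prop. 4.1 (arXiv:math/0203120v7 p. 7, TeX l.632–655)] -/
theorem Burnol2004b_prop4_1_i_strip {a : ℝ} (ha : 0 < a) {f : Lp ℂ 2 (volume : Measure ℝ)}
    (hf : f ∈ sonineL a) :
    (∃ F : ℂ → ℂ, IsHardyRight F ∧ ∀ s : ℂ, 1 / 2 < s.re → s.re < 1 →
        F s = (a : ℂ) ^ s * ((s - 1) / s) * rightMellin (f : ℝ → ℂ) s) ∧
    (∃ F : ℂ → ℂ, IsHardyRight F ∧ ∀ s : ℂ, 1 / 2 < s.re → s.re < 1 →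
        F s = (a : ℂ) ^ s * ((s - 1) / s) *
          rightMellin ((𝓕 f : Lp ℂ 2 (volume : Measure ℝ)) : ℝ → ℂ) s) := by
  obtain ⟨c, hc⟩ := hf.2.1
  obtain ⟨c', hc'⟩ := (fourier_mem_sonineL hf).2.1
  exact ⟨exists_isHardyRight_eq_rightMellin ha _ (Lp.memLp f) hc,
    exists_isHardyRight_eq_rightMellin ha _ (Lp.memLp _) hc'⟩

/-- **R6a closer: conjunct (i) of the repaired fact `Burnol2004b_prop4_1R`, verbatim shape** (for the
eventual assembly of `Burnol2004b_prop4_1R_holds` from (i), (ii), (iii)).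
[cite: Burnol2004b, Prop. 4.1 (arXiv:math/0203120v7 p. 7, TeX l.632–655)] -/
theorem Burnol2004b_prop4_1R_i :
    ∀ a : ℝ, 0 < a → ∀ f ∈ sonineL a,
      (∃ F : ℂ → ℂ, IsHardyRight F ∧ ∀ s : ℂ, 1 / 2 < s.re → s.re < 1 →
        F s = (a : ℂ) ^ s * ((s - 1) / s) * rightMellin f s) ∧
      (∃ F : ℂ → ℂ, IsHardyRight F ∧ ∀ s : ℂ, 1 / 2 < s.re → s.re < 1 →
        F s = (a : ℂ) ^ s * ((s - 1) / s) *
          rightMellin (𝓕 f : Lp ℂ 2 (volume : Measure ℝ)) s) :=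
  fun _ ha _ hf ↦ Burnol2004b_prop4_1_i_strip ha hf

namespace Burnol2004bHardyStrip

/-- The punctured half-plane `{Re s > 1/2} ∖ {1}` is preconnected (union of the convex pieces
`1/2 < Re s < 1`, `Im s > 0`, `Re s > 1`, `Im s < 0`, consecutive ones overlapping). [folklore] -/
private theorem isPreconnected_halfPlane_diff_one :
    IsPreconnected ({s : ℂ | 1 / 2 < s.re} \ {1}) := by
  set A : Set ℂ := {s | 1 / 2 < s.re} ∩ {s | s.re < 1} with hA
  set B : Set ℂ := {s | 1 / 2 < s.re} ∩ {s | 0 < s.im} with hB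
  set C : Set ℂ := {s | 1 < s.re} with hC
  set D : Set ℂ := {s | 1 / 2 < s.re} ∩ {s | s.im < 0} with hD
  have hAc : IsPreconnected A :=
    ((convex_halfSpace_re_gt (1 / 2)).inter (convex_halfSpace_re_lt 1)).isPreconnected
  have hBc : IsPreconnected B :=
    ((convex_halfSpace_re_gt (1 / 2)).inter (convex_halfSpace_im_gt 0)).isPreconnected
  have hCc : IsPreconnected C := (convex_halfSpace_re_gt 1).isPreconnected
  have hDc : IsPreconnected D :=
    ((convex_halfSpace_re_gt (1 / 2)).inter (convex_halfSpace_im_lt 0)).isPreconnected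
  have hAB : IsPreconnected (A ∪ B) :=
    IsPreconnected.union (Complex.mk (3 / 4) 1) ⟨by norm_num [hA], by norm_num [hA]⟩
      ⟨by norm_num [hB], by norm_num [hB]⟩ hAc hBc
  have hABC : IsPreconnected (A ∪ B ∪ C) :=
    IsPreconnected.union (Complex.mk 2 1) (Or.inr ⟨by norm_num [hB], by norm_num [hB]⟩)
      (by norm_num [hC]) hAB hCc
  have hABCD : IsPreconnected (A ∪ B ∪ C ∪ D) :=
    IsPreconnected.union (Complex.mk 2 (-1)) (Or.inr (by norm_num [hC]))
      ⟨by norm_num [hD], by norm_num [hD]⟩ hABC hDc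
  have heq : ({s : ℂ | 1 / 2 < s.re} \ {1}) = A ∪ B ∪ C ∪ D := by
    ext s
    simp only [Set.mem_sdiff, mem_setOf_eq, mem_singleton_iff, mem_union, mem_inter_iff, hA, hB, hC, hD]
    constructor
    · rintro ⟨h1, h2⟩
      rcases lt_trichotomy s.im 0 with him | him | him
      · exact Or.inr ⟨h1, him⟩
      · rcases lt_trichotomy s.re 1 with hre | hre | hre
        · exact Or.inl (Or.inl (Or.inl ⟨h1, hre⟩))
        · exact absurd (Complex.ext (by simp [hre]) (by simp [him])) h2
        · exact Or.inl (Or.inr hre)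
      · exact Or.inl (Or.inl (Or.inr ⟨h1, him⟩))
    · rintro (((⟨h1, hre⟩ | ⟨h1, him⟩) | hre) | ⟨h1, him⟩)
      · exact ⟨h1, fun h ↦ by rw [h, one_re] at hre; exact lt_irrefl _ hre⟩
      · exact ⟨h1, fun h ↦ by rw [h, one_im] at him; exact lt_irrefl _ him⟩
      · refine ⟨?_, fun h ↦ by rw [h, one_re] at hre; exact lt_irrefl _ hre⟩
        show (1 : ℝ) / 2 < s.re
        linarith
      · exact ⟨h1, fun h ↦ by rw [h, one_im] at him; exact lt_irrefl _ him⟩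
  rw [heq]
  exact hABCD

end Burnol2004bHardyStrip

open Burnol2004bHardyStrip in
/-- **Bridge to the continued transform (identity theorem).** If `F ∈ ℍ²` agrees with
`a^s·((s−1)/s)·f̂(s)` on the strip `1/2 < Re s < 1` and `G` is any holomorphic continuation of `f̂` to
`ℂ ∖ {1}` (`HasRightMellinContinuation f G` — for `f ∈ L_a` its existence is Prop. 2.2), then
`F(s) = a^s·((s−1)/s)·G(s)` on the whole punctured half-plane `{Re s > 1/2} ∖ {1}`; i.e. the printed
"`G_f ∈ (s/(s−1))A^sℍ²`" with the removable singularity at `s = 1` filled in by `F(1)`.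
[cite: Burnol2004b, Prop. 4.1 with Prop. 2.2 (arXiv:math/0203120v7 pp. 5, 7; TeX l.460–469, 646–655)] -/
theorem Burnol2004b_prop4_1_i_of_continuation {a : ℝ} (ha : 0 < a) {f : ℝ → ℂ} {F G : ℂ → ℂ}
    (hF : IsHardyRight F)
    (hFs : ∀ s : ℂ, 1 / 2 < s.re → s.re < 1 → F s = (a : ℂ) ^ s * ((s - 1) / s) * rightMellin f s)
    (hG : HasRightMellinContinuation f G) :
    EqOn F (fun s ↦ (a : ℂ) ^ s * ((s - 1) / s) * G s) ({s : ℂ | 1 / 2 < s.re} \ {1}) := by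
  have ha0 : (a : ℂ) ≠ 0 := ofReal_ne_zero.2 ha.ne'
  set U : Set ℂ := {s : ℂ | 1 / 2 < s.re} \ {1} with hU
  have hUo : IsOpen U := (isOpen_lt continuous_const Complex.continuous_re).sdiff isClosed_singleton
  have hUsub : U ⊆ {s : ℂ | 1 / 2 < s.re} := sdiff_subset
  have hne0 : ∀ s ∈ U, s ≠ 0 := by
    intro s hs h
    have h12 : 1 / 2 < s.re := hUsub hs
    rw [h, Complex.zero_re] at h12
    linarith
  have hF' : AnalyticOnNhd ℂ F U := (hF.1.mono hUsub).analyticOnNhd hUo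
  have hR : DifferentiableOn ℂ (fun s ↦ (a : ℂ) ^ s * ((s - 1) / s) * G s) U := by
    refine (DifferentiableOn.mul (fun s _ ↦ ?_) ?_).mul (hG.1.mono fun s hs ↦ hs.2)
    · exact (differentiableAt_id.const_cpow (Or.inl ha0)).differentiableWithinAt
    · exact (differentiableOn_id.sub (differentiableOn_const (1 : ℂ))).div differentiableOn_id hne0
  have hR' : AnalyticOnNhd ℂ (fun s ↦ (a : ℂ) ^ s * ((s - 1) / s) * G s) U := hR.analyticOnNhd hUo
  -- agreement near the point `3/4` of the strip
  have hstrip : IsOpen {s : ℂ | 1 / 2 < s.re ∧ s.re < 1} :=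
    (isOpen_lt continuous_const Complex.continuous_re).inter
      (isOpen_lt Complex.continuous_re continuous_const)
  have hmem : (Complex.mk (3 / 4) 0) ∈ {s : ℂ | 1 / 2 < s.re ∧ s.re < 1} := by
    simp only [mem_setOf_eq]; norm_num
  have hz0 : (Complex.mk (3 / 4) 0) ∈ U := by
    refine ⟨by simp only [mem_setOf_eq]; norm_num, fun h ↦ ?_⟩
    have := congrArg Complex.re (mem_singleton_iff.1 h)
    norm_num at this
  have hev : F =ᶠ[𝓝 (Complex.mk (3 / 4) 0)] fun s ↦ (a : ℂ) ^ s * ((s - 1) / s) * G s := by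
    filter_upwards [hstrip.mem_nhds hmem] with s hs
    rw [hFs s hs.1 hs.2, hG.2 s hs.1 hs.2]
  exact hF'.eqOn_of_preconnected_of_eventuallyEq hR' isPreconnected_halfPlane_diff_one hz0 hev

/-- The same bridge for the tree's continued transform `rightMellinExt f`, under the existence of a
continuation (Prop. 2.2 (i) for `f ∈ L_a`).
[cite: Burnol2004b, Prop. 4.1 with Prop. 2.2 (arXiv:math/0203120v7 pp. 5, 7; TeX l.460–469, 646–655)] -/
theorem Burnol2004b_prop4_1_i_rightMellinExt {a : ℝ} (ha : 0 < a) {f : ℝ → ℂ} {F : ℂ → ℂ}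
    (hF : IsHardyRight F)
    (hFs : ∀ s : ℂ, 1 / 2 < s.re → s.re < 1 → F s = (a : ℂ) ^ s * ((s - 1) / s) * rightMellin f s)
    (hex : ∃ G, HasRightMellinContinuation f G) :
    EqOn F (fun s ↦ (a : ℂ) ^ s * ((s - 1) / s) * rightMellinExt f s) ({s : ℂ | 1 / 2 < s.re} \ {1}) :=
  Burnol2004b_prop4_1_i_of_continuation ha hF hFs (hasRightMellinContinuation_rightMellinExt hex)

end Literature.NumberTheory.LFunctions
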